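import Summits.Ventures.HSemireg.BlochSpreadOfObjectLevel
import Literature.AlgebraicGeometry.HodgeTheory.BlochSemiregularCompIso
import HarnessLib

/-!
# HSemireg (B1): the class-level spread fact from the two object-level printed facts ALONE

Venture `Summits/Ventures/HSemireg` (service: bridge typing (B1) «VHC-instance ⇒ whole-component
algebraicity»; HONEST FRAMING: nothing here proves HC / HC_CM / HC_AV, no object is certified).

The capstone `Bloch1972.blochSemiregularSpread_of_blochLifts_of_fulton_of_isoInvariance`
(`BlochSpreadOfObjectLevel.lean`) derives the CLASS-level named fact `BlochSemiregularSpread n p`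
from the OBJECT-level printed facts `Bloch1972_semiregularSubschemeLifts` (Bloch 1972, Thm. (7.1)/(7.4))
and `fulton1998_flatFamily_cycleClass_specialises` (Fulton, Cor. 10.1 / 19.2) and ONE displayed
hypothesis `hT` — invariance of Bloch semiregularity `IsBlochSemiregular` under isomorphisms of the
ambient `ℂ`-scheme. That hypothesis is now the THEOREM
`Literature.AlgebraicGeometry.HodgeTheory.IsBlochSemiregular.comp_iso` (`BlochSemiregularCompIso.lean`:
transport of Bloch's pairing `Ωʲ → 𝓐lt_r(𝓘; Ωⁿ|_Z)` along the isomorphism — cotangent/Hodge sheaf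
pull-back, the ideal, `Ωⁿ|_Z`, the iterated internal Hom and its alternating part, and coherent
cohomology along an isomorphism), so the class-level fact follows from the two printed facts alone:
**`Bloch1972.blochSemiregularSpread_of_blochLifts_of_fulton`**.
-/

noncomputable section

open CategoryTheory AlgebraicGeometry

namespace Summit.Ventures.HSemireg

namespace Bloch1972

open Literature.AlgebraicGeometry.HodgeTheory

/-- **(B1) capstone, unconditional form**: Bloch's lifting theorem for semiregular local complete
intersections (object level) and Fulton's specialisation of cycle classes in flat families (object
level) imply the class-level spread fact `BlochSemiregularSpread n p`; the iso-invariance premise of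
`blochSemiregularSpread_of_blochLifts_of_fulton_of_isoInvariance` is discharged by
`IsBlochSemiregular.comp_iso`.
[cite: Bloch1972Semiregularity, Thm. (7.1) p. 64 and Thm. (7.4) with Remark (7.5) p. 65]
[cite: Fulton1998, §10.1 Cor. 10.1; §19.2 Cor. 19.2 (b)] -/
theorem blochSemiregularSpread_of_blochLifts_of_fulton (n p : ℕ)
    (hBl : Bloch1972_semiregularSubschemeLifts)
    (hFu : fulton1998_flatFamily_cycleClass_specialises) :
    BlochSemiregularSpread n p :=
  blochSemiregularSpread_of_blochLifts_of_fulton_of_isoInvariance n p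
    (fun _ _ φ _ i _ _ h => IsBlochSemiregular.comp_iso φ i h) hBl hFu

end Bloch1972

end Summit.Ventures.HSemireg

end
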